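import Mathlib.LinearAlgebra.FiniteDimensional.Lemmas
import Mathlib.Algebra.Algebra.Operations
import Literature.NumberTheory.Transcendental.BrownMotivicMZV

/-!
# Crux `HoffmanIndependence` (stmt-KontsevichZagierPeriods-15045), line `Sketch` — stub B2:
# amplification by rank–nullity ("`ker per` is an ideal of the domain `H`")

Over `M : Brown2012.MotivicMZV` with `H` an integral domain and filtered pieces
`H_{≤K} = ⨆_{k≤K} H_k` of dimension `d_{≤K} = ∑_{k≤K} d_k` (`hfin`): if `R ≠ 0` lies in `H_{≤N}`
and `per R = 0`, then for every `K ≥ N`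

  `dim_ℚ ⨆_{k≤K} hoffmanSpan k ≤ d_{≤K} - d_{≤K-N}`.

Proof. The real Hoffman span of weight `≤ K` lies in `per (H_{≤K})` (each generator `ζ(s)`,
`s ∈ {2,3}^×` of weight `k ≤ K`, is `per (Iᵐ(0; ρ(s.reverse); 1))` with
`Iᵐ(0; ρ(s.reverse); 1) ∈ H_k`: `per_J`, `J_rho_mem_hoffman`); multiplication by `R` maps
`H_{≤K-N}` into `H_{≤K}` (the weight is multiplicative, `mul_mem`) and into `ker per` (`per` is a
ring homomorphism), injectively (`H` is a domain); rank–nullity for `per|_{H_{≤K}}`.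
No new definitions.
-/

namespace Summit.KontsevichZagierPeriods.LinRedNormalForm.HoffmanIndependence

open Literature.NumberTheory.Transcendental MZV Brown2012

/-- Products of filtered pieces: `H_{≤a} · H_{≤b} ⊆ H_{≤a+b}`, from `H_i · H_j ⊆ H_{i+j}`
(`MotivicMZV.mul_mem`). -/
theorem biSup_Hw_mul_le (M : MotivicMZV) (a b : ℕ) :
    (⨆ k ∈ Finset.range (a + 1), M.Hw k) * (⨆ k ∈ Finset.range (b + 1), M.Hw k) ≤
      ⨆ k ∈ Finset.range (a + b + 1), M.Hw k := by
  simp_rw [Submodule.iSup_mul, Submodule.mul_iSup]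
  refine iSup₂_le fun i hi => iSup₂_le fun j hj => ?_
  have hij : i + j ∈ Finset.range (a + b + 1) := by
    simp only [Finset.mem_range] at hi hj ⊢
    omega
  calc M.Hw i * M.Hw j ≤ M.Hw (i + j) := Submodule.mul_le.2 fun _ hx _ hy => M.mul_mem hx hy
    _ ≤ ⨆ k ∈ Finset.range (a + b + 1), M.Hw k := le_biSup M.Hw hij

/-- The real Hoffman span of weight `≤ K` lies in the image of the filtered piece `H_{≤K}` under
the period map: `ζ(s) = per (Iᵐ(0; ρ(s.reverse); 1))` for `s ∈ {2,3}^×` (`per_J`, a Hoffman index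
being admissible) with `Iᵐ(0; ρ(s.reverse); 1) ∈ H_{|s|}` (`J_rho_mem_hoffman`). -/
theorem biSup_hoffmanSpan_le_map_per (M : MotivicMZV) (K : ℕ) :
    (⨆ k ∈ Finset.range (K + 1), hoffmanSpan k) ≤
      Submodule.map M.per.toLinearMap (⨆ k ∈ Finset.range (K + 1), M.Hw k) := by
  refine iSup₂_le fun k hk => Submodule.span_le.2 ?_
  rintro x ⟨s, hs, hw, rfl⟩
  have hrev : IsHoffman s.reverse := fun i hi => hs i (List.mem_reverse.1 hi)
  have h1 : M.J (rho s.reverse) ∈ M.Hw k := by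
    have h := M.J_rho_mem_hoffman hrev
    have hwr : weight s.reverse = k := by
      rw [← hw]; simp [weight, List.sum_reverse]
    rwa [hwr] at h
  have h2 : M.J (rho s.reverse) ∈ ⨆ k ∈ Finset.range (K + 1), M.Hw k := (le_biSup M.Hw hk) h1
  exact ⟨M.J (rho s.reverse), h2, by simp [M.per_J s hs.isAdmissible]⟩

/-- A filtered piece whose `finrank` is the (positive) number `d_{≤K}` is finite-dimensional
(`d_0 = 1` occurs in the sum; `finrank` vanishes on infinite-dimensional spaces). -/
theorem finiteDimensional_biSup_of_finrank (M : MotivicMZV) (K : ℕ)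
    (hfin : Module.finrank ℚ ↥(⨆ k ∈ Finset.range (K + 1), M.Hw k) =
      ∑ k ∈ Finset.range (K + 1), zagierDim k) :
    FiniteDimensional ℚ ↥(⨆ k ∈ Finset.range (K + 1), M.Hw k) := by
  refine Module.finite_of_finrank_pos ?_
  rw [hfin]
  have h : zagierDim 0 ≤ ∑ k ∈ Finset.range (K + 1), zagierDim k :=
    Finset.single_le_sum (f := zagierDim) (fun _ _ => Nat.zero_le _)
      (Finset.mem_range.2 (Nat.succ_pos K))
  exact lt_of_lt_of_le (by simp [zagierDim]) h

/-- **Stub B2** (amplification by rank–nullity). Let `M : MotivicMZV` with `H` a domain and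
filtered pieces `H_{≤K} = ⨆_{k≤K} H_k` of dimension `d_{≤K}` (`hfin`). If `R ≠ 0` lies in `H_{≤N}`
and `per R = 0`, then for every `K ≥ N` the real Hoffman span of weight `≤ K` has dimension at
most `d_{≤K} - d_{≤K-N}`: it is contained in the image of `H_{≤K}` under `per`, while `x ↦ R x`
maps `H_{≤K-N}` injectively (domain) into `ker per ∩ H_{≤K}` (`mul_mem`, `per` multiplicative), so
`dim per(H_{≤K}) = d_{≤K} - dim (ker per ∩ H_{≤K}) ≤ d_{≤K} - d_{≤K-N}`. -/
theorem stub_finrankLeOfKernelElement : ∀ (M : MotivicMZV) [IsDomain M.H],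
    (∀ K, Module.finrank ℚ ↥(⨆ k ∈ Finset.range (K + 1), M.Hw k) =
      ∑ k ∈ Finset.range (K + 1), zagierDim k) →
    ∀ {N : ℕ} {R : M.H}, R ≠ 0 → R ∈ (⨆ k ∈ Finset.range (N + 1), M.Hw k) → M.per R = 0 →
    ∀ K : ℕ, N ≤ K →
    Module.finrank ℚ ↥(⨆ k ∈ Finset.range (K + 1), hoffmanSpan k) ≤
      (∑ k ∈ Finset.range (K + 1), zagierDim k) -
        (∑ k ∈ Finset.range (K - N + 1), zagierDim k) := by
  intro M _ hfin N R hR hRN hper K hK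
  haveI := finiteDimensional_biSup_of_finrank M K (hfin K)
  haveI := finiteDimensional_biSup_of_finrank M (K - N) (hfin (K - N))
  -- the period map restricted to `H_{≤K}`
  let f : ↥(⨆ k ∈ Finset.range (K + 1), M.Hw k) →ₗ[ℚ] ℝ :=
    M.per.toLinearMap ∘ₗ (⨆ k ∈ Finset.range (K + 1), M.Hw k).subtype
  -- (1) the real Hoffman span of weight `≤ K` lies in `range f`
  have hrange : (⨆ k ∈ Finset.range (K + 1), hoffmanSpan k) ≤ LinearMap.range f := by
    rw [LinearMap.range_comp, Submodule.range_subtype]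
    exact biSup_hoffmanSpan_le_map_per M K
  -- (2) multiplication by `R` maps `H_{≤K-N}` into `ker f`, injectively
  have hmulmem : ∀ x ∈ (⨆ k ∈ Finset.range (K - N + 1), M.Hw k),
      R * x ∈ ⨆ k ∈ Finset.range (K + 1), M.Hw k := fun x hx => by
    have h := biSup_Hw_mul_le M N (K - N) (Submodule.mul_mem_mul hRN hx)
    have hNK : N + (K - N) = K := by omega
    rwa [hNK] at h
  let g₀ : ↥(⨆ k ∈ Finset.range (K - N + 1), M.Hw k) →ₗ[ℚ]
      ↥(⨆ k ∈ Finset.range (K + 1), M.Hw k) :=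
    ((LinearMap.mulLeft ℚ R) ∘ₗ (⨆ k ∈ Finset.range (K - N + 1), M.Hw k).subtype).codRestrict
      (⨆ k ∈ Finset.range (K + 1), M.Hw k) (fun x => hmulmem x.1 x.2)
  have hg₀ker : ∀ x, g₀ x ∈ LinearMap.ker f := fun x => by
    simp [f, g₀, LinearMap.mem_ker, map_mul, hper]
  let g : ↥(⨆ k ∈ Finset.range (K - N + 1), M.Hw k) →ₗ[ℚ] ↥(LinearMap.ker f) :=
    g₀.codRestrict (LinearMap.ker f) hg₀ker
  have hg : Function.Injective g := by
    intro x y hxy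
    apply Subtype.ext
    have h1 : (g₀ x : M.H) = (g₀ y : M.H) := by
      have := congrArg (fun z : ↥(LinearMap.ker f) => ((z : ↥(⨆ k ∈ Finset.range (K + 1), M.Hw k)) : M.H)) hxy
      simpa [g] using this
    have h2 : R * (x : M.H) = R * (y : M.H) := by simpa [g₀] using h1
    exact mul_left_cancel₀ hR h2
  -- (3) dimension count
  have hker : ∑ k ∈ Finset.range (K - N + 1), zagierDim k ≤
      Module.finrank ℚ ↥(LinearMap.ker f) := by
    rw [← hfin (K - N)]
    exact LinearMap.finrank_le_finrank_of_injective hg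
  have hrn := LinearMap.finrank_range_add_finrank_ker f
  rw [hfin K] at hrn
  have hle : Module.finrank ℚ ↥(⨆ k ∈ Finset.range (K + 1), hoffmanSpan k) ≤
      Module.finrank ℚ ↥(LinearMap.range f) :=
    LinearMap.finrank_le_finrank_of_injective (Submodule.inclusion_injective hrange)
  omega

end Summit.KontsevichZagierPeriods.LinRedNormalForm.HoffmanIndependence
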